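import Literature.NumberTheory.Rogawski1990.ArchOrbFamGHeldOutFamily               -- ★ p851298 (this seat): the ONE-place edition; `continuous_blockProj`; brings ★ (A4′), ★ (A5a) swap, ★ `coe_archPiEquivCM_symm_apply`
import HarnessLib

/-!
# (X-core) L3^E §1–§2: the HELD-OUT test family on `Π_{w ∈ E} U(α)_w` is a SMOOTH matrix-currency family with uniform compact support
# (engine: ★ (A4′) `contDiffOn_smoothModel_prod_param`; Varadarajan 1977 I §1.12, Rogawski 1990 §8.2–8.3, Hörmander Thm. 1.1.9)

Topic `NumberTheory/Rogawski1990`; namespace `Literature.NumberTheory.Rogawski1990`.  THEOREMS ONLY (no `def`, no instance, no notation, no axiom, no named fact, no `sorry`);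
kernel lane `--kind proof --supports stmt-HodgeConjecture-24833`.  Cell `pub/hodgecm-mathlib`, crux H413 (`stmt-HodgeConjecture-24833`), F0∕P3c line LH3 (closer stub `stub_N9`),
organ O-L1e-b «(I₁) AT CROSS-PLACE CORNERS MEETING A REAL WALL» (LH3-plan (g4) DEAL BY NAME 2026-09-02T12:00:29Z: (X-core) road owner LH5-p02 (g4); hands L1^ι ★
`ArchLocalWallDescentParamPi`, L2^E F0P3b-p01 (g17) `ArchOrbFamGUnfoldedModelHeldOutFinsetPiIterated`, L3^E = this file (family) + `ArchOrbFamGExtBoxDescentCorners` (core + head)).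
The finset edition of ★ p851298 `ArchOrbFamGHeldOutFamily`: the ONE held-out place `w₀` becomes a finite set `E` of compact places (`E ∩ S′ = ∅`), the held-out variable a
tuple `u ∈ Π_{ιE} U(α)_w` (`ιE = {w ∉ S′, w ∈ E}` as a nested subtype, L2^E's convention), the rest index `ιR = {w ∉ S′, w ∉ E}`.
* §1 `exists_contDiff_recombineMatrix_heldOutFinset` — the three-way linear recombination with the `E`-blocks free.
* §2 **`exists_smooth_heldOut_family_finset`** — (a) joint smoothness on the in-regular box × `M₃(ℂ)^{ιE}` (★ (A4′)), (b) ONE compact `u`-support, (c) `B(c, u) = Ξ(c, ↑↑u)`,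
  (d) `Ξ` does not see the `E`-coordinates.
HONEST LABEL: HC_CM is proved only modulo the 7 printed citations (2 remaining: hLiu418 = `stmt-HodgeConjecture-24832`, h413 = `stmt-HodgeConjecture-24833`) until rung 0
closes; count-neutral letter-L1 plumbing.

## References
* [Varadarajan1977] V. S. Varadarajan, *Harmonic Analysis on Real Reductive Groups*, LNM 576 (1977), Part I §1.12.
* [Rogawski1990] J. D. Rogawski, *Automorphic Representations of Unitary Groups in Three Variables*, Ann. of Math. Stud. 123 (1990), §4.12 Lemma 4.12.1 p. 61, §8.2–§8.3 pp. 118–124.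
* [HormanderALPDO1] L. Hörmander, *The Analysis of Linear Partial Differential Operators I*, 2nd ed. (1990), §1.1 Thm. 1.1.9.
* [BorelJacquet1979] A. Borel, H. Jacquet, *Automorphic forms and automorphic representations*, PSPM 33.1 (1979), §4.1.
* [DeitmarEchterhoff2014] A. Deitmar, S. Echterhoff, *Principles of Harmonic Analysis*, 2nd ed. (2014), Lemma 9.3.3.
-/

set_option autoImplicit false

noncomputable section

open MeasureTheory MeasureTheory.Measure Matrix NumberField NumberField.InfinitePlace NumberField.mixedEmbedding Set Function Topology Complex
open Literature.MeasureTheory.Group Literature.NumberTheory.Rogawski1990 Literature.NumberTheory.Automorphic.ArchCartan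
open Literature.NumberTheory.Automorphic Literature.NumberTheory.Automorphic.UnitaryGroup
open scoped MatrixGroups ContDiff Classical
open scoped Matrix.Norms.Operator

namespace Literature.NumberTheory.Rogawski1990

/-! ## §1 The three-way recombination matrix with the `E`-blocks free -/

section Recombine

variable (L : Type) [Field L] [NumberField L] (S' E : Finset {w : InfinitePlace L // IsComplex w})

/-- **The THREE-WAY recombination with a FINITE SET `E` of held-out places is LINEAR in the ambient matrices, hence `C^∞`**: for fixed conjugating matrices `P_w, Q_w`
(`w ∈ S′`), `((m_g, m_u), X) ↦ Matrix.of (i, j) ↦ (0, w ↦ [w ∈ S′] (P_w m_u(w) Q_w)_{ij} ∣ [w ∉ S′, w ∈ E] X(w)_{ij} ∣ [w ∉ S′, w ∉ E] m_g(w)_{ij})` into `M₃(L ⊗ ℝ)`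
(the `E`-blocks HELD OUT as free matrix variables).  The finset edition of ★ `exists_contDiff_recombineMatrix_heldOut`. [cite: BorelJacquet1979, §4.1] -/
theorem exists_contDiff_recombineMatrix_heldOutFinset (P Q : ↥S' → Matrix (Fin 3) (Fin 3) ℂ) :
    ∃ Λ : ((({w : {w : {w : InfinitePlace L // IsComplex w} // w ∉ S'} // w.1 ∉ E} → Matrix (Fin 3) (Fin 3) ℂ) × (↥S' → Matrix (Fin 3) (Fin 3) ℂ)) ×
        ({w : {w : {w : InfinitePlace L // IsComplex w} // w ∉ S'} // w.1 ∈ E} → Matrix (Fin 3) (Fin 3) ℂ)) → Matrix (Fin 3) (Fin 3) (mixedSpace L),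
      ContDiff ℝ ∞ Λ ∧ ∀ mg mu X, Λ ((mg, mu), X) = Matrix.of fun i j => ((0 : {w : InfinitePlace L // IsReal w} → ℝ),
        fun w : {w : InfinitePlace L // IsComplex w} =>
          if h : w ∈ S' then (P ⟨w, h⟩ * mu ⟨w, h⟩ * Q ⟨w, h⟩) i j else if hE : w ∈ E then X ⟨⟨w, h⟩, hE⟩ i j else mg ⟨⟨w, h⟩, hE⟩ i j) := by
  classical
  let Λ : ((({w : {w : {w : InfinitePlace L // IsComplex w} // w ∉ S'} // w.1 ∉ E} → Matrix (Fin 3) (Fin 3) ℂ) × (↥S' → Matrix (Fin 3) (Fin 3) ℂ)) ×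
        ({w : {w : {w : InfinitePlace L // IsComplex w} // w ∉ S'} // w.1 ∈ E} → Matrix (Fin 3) (Fin 3) ℂ)) →ₗ[ℝ] Matrix (Fin 3) (Fin 3) (mixedSpace L) :=
    { toFun := fun p => Matrix.of fun i j => ((0 : {w : InfinitePlace L // IsReal w} → ℝ),
        fun w : {w : InfinitePlace L // IsComplex w} =>
          if h : w ∈ S' then (P ⟨w, h⟩ * p.1.2 ⟨w, h⟩ * Q ⟨w, h⟩) i j else if hE : w ∈ E then p.2 ⟨⟨w, h⟩, hE⟩ i j else p.1.1 ⟨⟨w, h⟩, hE⟩ i j)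
      map_add' := fun p q => by
        ext i j
        · simp
        · rename_i w
          simp only [Prod.fst_add, Prod.snd_add, Matrix.of_apply, Matrix.add_apply, Pi.add_apply]
          split_ifs with h hE
          · rw [Matrix.mul_add, Matrix.add_mul, Matrix.add_apply]
          · rfl
          · rfl
      map_smul' := fun c p => by
        ext i j
        · simp
        · rename_i w
          simp only [Prod.smul_fst, Prod.smul_snd, Matrix.of_apply, Matrix.smul_apply, RingHom.id_apply, Pi.smul_apply]
          split_ifs with h hE
          · rw [Matrix.mul_smul, Matrix.smul_mul, Matrix.smul_apply]
          · rfl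
          · rfl }
  exact ⟨Λ, (LinearMap.toContinuousLinearMap Λ).contDiff, fun mg mu X => rfl⟩

end Recombine


/-! ## §2 The held-out family is a smooth matrix-currency family with uniform support -/

section HeldOut

variable (L : Type) [Field L] [NumberField L] [IsCMField L] (α : Fin 3 → L) (S' : Finset {w : InfinitePlace L // IsComplex w})

/-- **(X-core) L3^E — THE HELD-OUT TEST FAMILY `u ↦ B(c, u)` ON `Π_{w ∈ E} U(α)_w` IS `Ξ(c, (↑↑u_w)_w)` FOR A JOINTLY SMOOTH `Ξ`, WITH ONE COMPACT `u`-SUPPORT FOR ALL `c`,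
AND `Ξ` DOES NOT SEE THE `E`-COORDINATES.**  The finset edition of ★ `exists_smooth_heldOut_family` (one held-out place `w₀`): data as there with a finite set `E` of
compact places (`hES : E ∩ S′ = ∅`) held out, the rest `ιR = {w ∉ S′, w ∉ E}` read through ONE quotient `X_rest` with a measure `Q_rest` finite on compacta; the inner family is
L2^E's (A5a″)^E integrand (F0P3b-p01 (g17) `orbFamG_eq_integral_unfoldedModel_heldOutFinsetPi_of_regG`) TOKEN FOR TOKEN:
`B(c, u) := ∫ a′ (e⁻¹ (w ↦ [w ∈ S′] φ_w⁻¹(k_w · τ(0,φ_w,θ_w) τ(x_w∕2,0,0) n_w τ(x_w∕2,0,0) · k_w⁻¹) ∣ [w ∈ E] u_w ∣ [rest] (g γ_rest(c) g⁻¹)_w)) d((⊗_{w∈S′} (κ ⊗ μ_N)) ⊗ Q_rest)`.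
Conclusion: `Ξ : (coordinates) × M₃(ℂ)^{ιE} → ℂ` with (a) `Ξ` is `ContDiffOn ℝ ∞` on `{c | in-regular at every compact place ∉ E} × M₃(ℂ)^{ιE}` (★ (A4′)); (b) ONE compact
`C₀ ⊆ Π_{ιE} U(α)_w` with `B(c, u) = 0` for `u ∉ C₀`, every `c`; (c) `B(c, u) = Ξ(c, (↑↑u_w)_w)`; (d) `Ξ(c, X) = Ξ(c′, X)` whenever `c` and `c′` agree off `E`.
[cite: Varadarajan1977, I §1.12] [cite: Rogawski1990, §8.2–§8.3 pp. 118–124; §4.12 Lemma 4.12.1 p. 61] [cite: HormanderALPDO1, §1.1 Thm. 1.1.9] [cite: DeitmarEchterhoff2014, Lemma 9.3.3] -/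
theorem exists_smooth_heldOut_family_finset (hα : ∀ i, α i ≠ 0) (hreal : ∀ (w : {w : InfinitePlace L // IsComplex w}) (i : Fin 3), (w.1.embedding (α i)).im = 0)
    (hS' : ∀ w, w ∈ S' → w ∈ splitChartPlaces L α) (E : Finset {w : InfinitePlace L // IsComplex w}) (hES : ∀ w, w ∈ E → w ∉ S')
    {J : Matrix (Fin 3) (Fin 3) ℂ} (hJ : J = (StdForm.antidiagonal 3).over ℂ)
    [MeasurableSpace ↥(unitaryGroupOfForm (starRingEnd ℂ) J)] [BorelSpace ↥(unitaryGroupOfForm (starRingEnd ℂ) J)]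
    (K : Subgroup ↥(unitaryGroupOfForm (starRingEnd ℂ) J)) (hK : IsCompact (K : Set ↥(unitaryGroupOfForm (starRingEnd ℂ) J)))
    (κ : Measure ↥K) [κ.IsHaarMeasure] (μN : Measure ↥(unipotentU (starRingEnd ℂ) J)) [μN.IsHaarMeasure]
    (φ : ∀ w : {w : {w : InfinitePlace L // IsComplex w} // w ∈ S'}, ↥(archLocal L 3 (Matrix.diagonal α) w.1) ≃ₜ* ↥(unitaryGroupOfForm (starRingEnd ℂ) J))
    (T : {w : {w : InfinitePlace L // IsComplex w} // w ∈ S'} → GL (Fin 3) ℂ)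
    (hT : ∀ (w : {w : {w : InfinitePlace L // IsComplex w} // w ∈ S'}) (h : ↥(archLocal L 3 (Matrix.diagonal α) w.1)),
      ((φ w h : ↥(unitaryGroupOfForm (starRingEnd ℂ) J)) : GL (Fin 3) ℂ) = T w * (h : GL (Fin 3) ℂ) * (T w)⁻¹)
    (τ : (Fin 3 → ℝ) → ↥(unitaryGroupOfForm (starRingEnd ℂ) J))
    (hτcoe : ∀ c, (((τ c : ↥(unitaryGroupOfForm (starRingEnd ℂ) J)) : GL (Fin 3) ℂ) : Matrix (Fin 3) (Fin 3) ℂ) = Matrix.diagonal (boostEig c))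
    [MeasurableSpace ((∀ w : {w : {w : {w : InfinitePlace L // IsComplex w} // w ∉ S'} // w.1 ∉ E}, ↥(archLocal L 3 (Matrix.diagonal α) w.1.1)) ⧸
      Subgroup.pi Set.univ (fun w : {w : {w : {w : InfinitePlace L // IsComplex w} // w ∉ S'} // w.1 ∉ E} => chartTorusGLoc L α w.1.1 S'))]
    [BorelSpace ((∀ w : {w : {w : {w : InfinitePlace L // IsComplex w} // w ∉ S'} // w.1 ∉ E}, ↥(archLocal L 3 (Matrix.diagonal α) w.1.1)) ⧸
      Subgroup.pi Set.univ (fun w : {w : {w : {w : InfinitePlace L // IsComplex w} // w ∉ S'} // w.1 ∉ E} => chartTorusGLoc L α w.1.1 S'))]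
    (Qrest : Measure ((∀ w : {w : {w : {w : InfinitePlace L // IsComplex w} // w ∉ S'} // w.1 ∉ E}, ↥(archLocal L 3 (Matrix.diagonal α) w.1.1)) ⧸
      Subgroup.pi Set.univ (fun w : {w : {w : {w : InfinitePlace L // IsComplex w} // w ∉ S'} // w.1 ∉ E} => chartTorusGLoc L α w.1.1 S')))
    [IsFiniteMeasureOnCompacts Qrest] [SFinite Qrest]
    {a' : ↥(arch (↥(maximalRealSubfield L)) L (IsCMField.complexConj L) 3 (Matrix.diagonal α)) → ℂ} (ha' : ArchSmooth L 3 (Matrix.diagonal α) a') :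
    ∃ Ξ : (({w : InfinitePlace L // IsComplex w} → Fin 3 → ℝ) × ({w : {w : {w : InfinitePlace L // IsComplex w} // w ∉ S'} // w.1 ∈ E} → Matrix (Fin 3) (Fin 3) ℂ)) → ℂ,
      ContDiffOn ℝ ∞ Ξ ({c : {w : InfinitePlace L // IsComplex w} → Fin 3 → ℝ |
          ∀ (i : {w : {w : {w : InfinitePlace L // IsComplex w} // w ∉ S'} // w.1 ∉ E}) (a b : Fin 3), a ≠ b →
            slotSign L α i.1.1 a ≠ slotSign L α i.1.1 b → Circle.exp (c i.1.1 a) ≠ Circle.exp (c i.1.1 b)} ×ˢ Set.univ) ∧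
      (∃ C₀ : Set (∀ w : {w : {w : {w : InfinitePlace L // IsComplex w} // w ∉ S'} // w.1 ∈ E}, ↥(archLocal L 3 (Matrix.diagonal α) w.1.1)), IsCompact C₀ ∧
        ∀ (c : {w : InfinitePlace L // IsComplex w} → Fin 3 → ℝ) (u : ∀ w : {w : {w : {w : InfinitePlace L // IsComplex w} // w ∉ S'} // w.1 ∈ E}, ↥(archLocal L 3 (Matrix.diagonal α) w.1.1)), u ∉ C₀ →
          (∫ q : ({w : {w : InfinitePlace L // IsComplex w} // w ∈ S'} → ↥K × ↥(unipotentU (starRingEnd ℂ) J)) ×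
                ((∀ w : {w : {w : {w : InfinitePlace L // IsComplex w} // w ∉ S'} // w.1 ∉ E}, ↥(archLocal L 3 (Matrix.diagonal α) w.1.1)) ⧸
                  Subgroup.pi Set.univ (fun w : {w : {w : {w : InfinitePlace L // IsComplex w} // w ∉ S'} // w.1 ∉ E} => chartTorusGLoc L α w.1.1 S')),
            a' ((archPiEquivCM 3 L (Matrix.diagonal α)).symm (fun w =>
              if h : w ∈ S' then
                (φ ⟨w, h⟩).symm (((q.1 ⟨w, h⟩).1 : ↥(unitaryGroupOfForm (starRingEnd ℂ) J)) *
                  (τ ![0, c w 1, c w 2] * τ ![c w 0 / 2, 0, 0] * ((q.1 ⟨w, h⟩).2 : ↥(unitaryGroupOfForm (starRingEnd ℂ) J)) * τ ![c w 0 / 2, 0, 0]) *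
                  ((q.1 ⟨w, h⟩).1 : ↥(unitaryGroupOfForm (starRingEnd ℂ) J))⁻¹)
              else if hE : w ∈ E then (u ⟨⟨w, h⟩, hE⟩ : ↥(archLocal L 3 (Matrix.diagonal α) w))
              else
                descConj (fun w : {w : {w : {w : InfinitePlace L // IsComplex w} // w ∉ S'} // w.1 ∉ E} => gprimeBlock L α w.1.1 S' c)
                  (Subgroup.pi Set.univ (fun w : {w : {w : {w : InfinitePlace L // IsComplex w} // w ∉ S'} // w.1 ∉ E} => chartTorusGLoc L α w.1.1 S'))
                  (forall_mem_pi_chartTorusGLoc_comm L α S' (fun w : {w : {w : {w : InfinitePlace L // IsComplex w} // w ∉ S'} // w.1 ∉ E} => w.1.1) c)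
                  (fun g => (g ⟨⟨w, h⟩, hE⟩ : ↥(archLocal L 3 (Matrix.diagonal α) w))) q.2))
            ∂((Measure.pi fun _ : {w : {w : InfinitePlace L // IsComplex w} // w ∈ S'} => κ.prod μN).prod Qrest)) = 0) ∧
      (∀ (c : {w : InfinitePlace L // IsComplex w} → Fin 3 → ℝ) (u : ∀ w : {w : {w : {w : InfinitePlace L // IsComplex w} // w ∉ S'} // w.1 ∈ E}, ↥(archLocal L 3 (Matrix.diagonal α) w.1.1)),
          (∫ q : ({w : {w : InfinitePlace L // IsComplex w} // w ∈ S'} → ↥K × ↥(unipotentU (starRingEnd ℂ) J)) ×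
                ((∀ w : {w : {w : {w : InfinitePlace L // IsComplex w} // w ∉ S'} // w.1 ∉ E}, ↥(archLocal L 3 (Matrix.diagonal α) w.1.1)) ⧸
                  Subgroup.pi Set.univ (fun w : {w : {w : {w : InfinitePlace L // IsComplex w} // w ∉ S'} // w.1 ∉ E} => chartTorusGLoc L α w.1.1 S')),
            a' ((archPiEquivCM 3 L (Matrix.diagonal α)).symm (fun w =>
              if h : w ∈ S' then
                (φ ⟨w, h⟩).symm (((q.1 ⟨w, h⟩).1 : ↥(unitaryGroupOfForm (starRingEnd ℂ) J)) *
                  (τ ![0, c w 1, c w 2] * τ ![c w 0 / 2, 0, 0] * ((q.1 ⟨w, h⟩).2 : ↥(unitaryGroupOfForm (starRingEnd ℂ) J)) * τ ![c w 0 / 2, 0, 0]) *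
                  ((q.1 ⟨w, h⟩).1 : ↥(unitaryGroupOfForm (starRingEnd ℂ) J))⁻¹)
              else if hE : w ∈ E then (u ⟨⟨w, h⟩, hE⟩ : ↥(archLocal L 3 (Matrix.diagonal α) w))
              else
                descConj (fun w : {w : {w : {w : InfinitePlace L // IsComplex w} // w ∉ S'} // w.1 ∉ E} => gprimeBlock L α w.1.1 S' c)
                  (Subgroup.pi Set.univ (fun w : {w : {w : {w : InfinitePlace L // IsComplex w} // w ∉ S'} // w.1 ∉ E} => chartTorusGLoc L α w.1.1 S'))
                  (forall_mem_pi_chartTorusGLoc_comm L α S' (fun w : {w : {w : {w : InfinitePlace L // IsComplex w} // w ∉ S'} // w.1 ∉ E} => w.1.1) c)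
                  (fun g => (g ⟨⟨w, h⟩, hE⟩ : ↥(archLocal L 3 (Matrix.diagonal α) w))) q.2))
            ∂((Measure.pi fun _ : {w : {w : InfinitePlace L // IsComplex w} // w ∈ S'} => κ.prod μN).prod Qrest)) =
          Ξ (c, fun w => (((u w : ↥(archLocal L 3 (Matrix.diagonal α) w.1.1)) : GL (Fin 3) ℂ) : Matrix (Fin 3) (Fin 3) ℂ))) ∧
      (∀ (c c' : {w : InfinitePlace L // IsComplex w} → Fin 3 → ℝ) (X : {w : {w : {w : InfinitePlace L // IsComplex w} // w ∉ S'} // w.1 ∈ E} → Matrix (Fin 3) (Fin 3) ℂ), (∀ w, w ∉ E → c w = c' w) →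
        Ξ (c, X) = Ξ (c', X)) := by
  -- ### instances
  haveI : ∀ w : {w : InfinitePlace L // IsComplex w}, LocallyCompactSpace ↥(archLocal L 3 (Matrix.diagonal α) w) := fun w => locallyCompactSpace_archLocal_three L α w
  haveI : ∀ w : {w : InfinitePlace L // IsComplex w}, SecondCountableTopology ↥(archLocal L 3 (Matrix.diagonal α) w) := fun w => secondCountableTopology_archLocal_three L α w
  have hN : IsClosed (unipotentU (starRingEnd ℂ) J : Set ↥(unitaryGroupOfForm (starRingEnd ℂ) J)) := LineRing.isClosed_unipotentU _ _
  have hJJ : J * J = 1 := by rw [hJ]; exact StdForm.over_mul_over _ _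
  have hJdet : J.det ≠ 0 := by
    intro h
    have h1 := congrArg Matrix.det hJJ
    rw [Matrix.det_mul, h, zero_mul, Matrix.det_one] at h1
    exact zero_ne_one h1
  haveI : LocallyCompactSpace ↥(unitaryGroupOfForm (starRingEnd ℂ) J) := locallyCompactSpace_unitaryGroupOfForm_complex J
  haveI : SecondCountableTopology ↥(unitaryGroupOfForm (starRingEnd ℂ) J) := secondCountableTopology_unitaryGroupOfForm_complex J
  haveI : SecondCountableTopology ↥(unipotentU (starRingEnd ℂ) J) := TopologicalSpace.Subtype.secondCountableTopology _
  haveI : SecondCountableTopology ↥K := TopologicalSpace.Subtype.secondCountableTopology _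
  haveI : BorelSpace ↥(unipotentU (starRingEnd ℂ) J) := Subtype.borelSpace _
  haveI : BorelSpace ↥K := Subtype.borelSpace _
  haveI : BorelSpace (↥K × ↥(unipotentU (starRingEnd ℂ) J)) := Prod.borelSpace
  haveI : CompactSpace ↥K := isCompact_iff_compactSpace.1 hK
  haveI : LocallyCompactSpace ↥K := hK.isClosed.isClosedEmbedding_subtypeVal.locallyCompactSpace
  haveI : LocallyCompactSpace ↥(unipotentU (starRingEnd ℂ) J) := hN.isClosedEmbedding_subtypeVal.locallyCompactSpace
  haveI : IsFiniteMeasureOnCompacts (Measure.pi fun _ : {w : {w : InfinitePlace L // IsComplex w} // w ∈ S'} => κ.prod μN) := inferInstance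
  -- the closed embeddings `U(α)_w ↪ M₃(ℂ)` and `U(J) ↪ M₃(ℂ)`
  have hemb : ∀ w : {w : InfinitePlace L // IsComplex w},
      IsClosedEmbedding (fun g : ↥(archLocal L 3 (Matrix.diagonal α) w) => ((g : GL (Fin 3) ℂ) : Matrix (Fin 3) (Fin 3) ℂ)) := fun w => by
    have hD : (Matrix.diagonal α).map w.1.embedding = Matrix.diagonal fun i => ((formRe L α w i : ℝ) : ℂ) := diagonal_map_embedding_eq_of_real (hreal w)
    have hdet : ((Matrix.diagonal α).map w.1.embedding).det ≠ 0 := by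
      rw [hD, Matrix.det_diagonal]
      exact Finset.prod_ne_zero_iff.2 fun i _ => by exact_mod_cast formRe_ne_zero hα (hreal w) i
    exact isClosedEmbedding_coe_unitaryGroupOfForm _ hdet
  have hembJ : IsClosedEmbedding (fun g : ↥(unitaryGroupOfForm (starRingEnd ℂ) J) => ((g : GL (Fin 3) ℂ) : Matrix (Fin 3) (Fin 3) ℂ)) :=
    isClosedEmbedding_coe_unitaryGroupOfForm _ hJdet
  have hcoeJ : Continuous fun w : ↥(unitaryGroupOfForm (starRingEnd ℂ) J) => ((w : GL (Fin 3) ℂ) : Matrix (Fin 3) (Fin 3) ℂ) :=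
    Units.continuous_val.comp continuous_subtype_val
  -- ### the ambient lift of `a′` and the three-way recombination
  obtain ⟨Θa, hΘa, hΘac, -, hΘf⟩ := ha'.exists_contDiff
  obtain ⟨Λ, hΛ, hΛapply⟩ := exists_contDiff_recombineMatrix_heldOutFinset L S' E
    (fun w : {w : {w : InfinitePlace L // IsComplex w} // w ∈ S'} => (((T w)⁻¹ : GL (Fin 3) ℂ) : Matrix (Fin 3) (Fin 3) ℂ))
    (fun w : {w : {w : InfinitePlace L // IsComplex w} // w ∈ S'} => ((T w : GL (Fin 3) ℂ) : Matrix (Fin 3) (Fin 3) ℂ))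
  have hsymm : ∀ (w : {w : {w : InfinitePlace L // IsComplex w} // w ∈ S'}) (v : ↥(unitaryGroupOfForm (starRingEnd ℂ) J)),
      (((φ w).symm v : ↥(archLocal L 3 (Matrix.diagonal α) w.1)) : GL (Fin 3) ℂ) = (T w)⁻¹ * (v : GL (Fin 3) ℂ) * T w := fun w v => by
    have h := hT w ((φ w).symm v)
    rw [ContinuousMulEquiv.apply_symm_apply] at h
    rw [h]
    group
  -- the block projections read the blocks of `Λ`
  have hproj_rest : ∀ (w : {w : {w : {w : InfinitePlace L // IsComplex w} // w ∉ S'} // w.1 ∉ E}) mg mu X,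
      (Matrix.of fun i j => (Λ ((mg, mu), X) i j).2 w.1.1 : Matrix (Fin 3) (Fin 3) ℂ) = mg w := by
    intro w mg mu X
    ext i j
    rw [Matrix.of_apply, hΛapply, Matrix.of_apply]
    dsimp only
    rw [dif_neg w.1.2, dif_neg w.2]
  have hproj_split : ∀ (w : {w : {w : InfinitePlace L // IsComplex w} // w ∈ S'}) mg mu X,
      (Matrix.of fun i j => (Λ ((mg, mu), X) i j).2 w.1 : Matrix (Fin 3) (Fin 3) ℂ) =
        (((T w)⁻¹ : GL (Fin 3) ℂ) : Matrix (Fin 3) (Fin 3) ℂ) * mu w * ((T w : GL (Fin 3) ℂ) : Matrix (Fin 3) (Fin 3) ℂ) := by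
    intro w mg mu X
    ext i j
    rw [Matrix.of_apply, hΛapply, Matrix.of_apply]
    dsimp only
    rw [dif_pos w.2]
  -- ### the abstract integrand `F`, its smooth reading `Θ₄` through the fibre datum `r`, and `Ξ`
  obtain ⟨G, hGdef⟩ : ∃ G : (({w : {w : InfinitePlace L // IsComplex w} // w ∈ S'} → Fin 3 → ℝ) × ({w : {w : {w : InfinitePlace L // IsComplex w} // w ∉ S'} // w.1 ∈ E} → Matrix (Fin 3) (Fin 3) ℂ)) →
      (∀ w : {w : {w : {w : InfinitePlace L // IsComplex w} // w ∉ S'} // w.1 ∉ E}, ↥(archLocal L 3 (Matrix.diagonal α) w.1.1)) →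
      ({w : {w : InfinitePlace L // IsComplex w} // w ∈ S'} → ↥K × ↥(unipotentU (starRingEnd ℂ) J)) → ℂ,
      G = fun q g η => Θa (Λ ((fun w => (((g w : ↥(archLocal L 3 (Matrix.diagonal α) w.1.1)) : GL (Fin 3) ℂ) : Matrix (Fin 3) (Fin 3) ℂ),
        fun j => ((((((η j).1 : ↥(unitaryGroupOfForm (starRingEnd ℂ) J)) *
          (τ ![0, q.1 j 1, q.1 j 2] * τ ![q.1 j 0 / 2, 0, 0] * ((η j).2 : ↥(unitaryGroupOfForm (starRingEnd ℂ) J)) * τ ![q.1 j 0 / 2, 0, 0]) *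
          ((η j).1 : ↥(unitaryGroupOfForm (starRingEnd ℂ) J))⁻¹ : ↥(unitaryGroupOfForm (starRingEnd ℂ) J)) : GL (Fin 3) ℂ) : Matrix (Fin 3) (Fin 3) ℂ))), q.2)) := ⟨_, rfl⟩
  -- the integrand sees the coordinates only through the SPLIT places (`w₀ ∉ S′`)
  obtain ⟨F, hFdef⟩ : ∃ F : (({w : InfinitePlace L // IsComplex w} → Fin 3 → ℝ) × ({w : {w : {w : InfinitePlace L // IsComplex w} // w ∉ S'} // w.1 ∈ E} → Matrix (Fin 3) (Fin 3) ℂ)) →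
      (∀ w : {w : {w : {w : InfinitePlace L // IsComplex w} // w ∉ S'} // w.1 ∉ E}, ↥(archLocal L 3 (Matrix.diagonal α) w.1.1)) →
      ({w : {w : InfinitePlace L // IsComplex w} // w ∈ S'} → ↥K × ↥(unipotentU (starRingEnd ℂ) J)) → ℂ,
      F = fun q g η => G (fun j : {w : {w : InfinitePlace L // IsComplex w} // w ∈ S'} => q.1 j.1, q.2) g η := ⟨_, rfl⟩
  let r : ({w : {w : InfinitePlace L // IsComplex w} // w ∈ S'} → ↥K × ↥(unipotentU (starRingEnd ℂ) J)) →
      ({w : {w : InfinitePlace L // IsComplex w} // w ∈ S'} → Matrix (Fin 3) (Fin 3) ℂ × Matrix (Fin 3) (Fin 3) ℂ × Matrix (Fin 3) (Fin 3) ℂ) :=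
    fun η j => ((((((η j).1 : ↥K) : ↥(unitaryGroupOfForm (starRingEnd ℂ) J)) : GL (Fin 3) ℂ) : Matrix (Fin 3) (Fin 3) ℂ),
      (((((η j).2 : ↥(unipotentU (starRingEnd ℂ) J)) : ↥(unitaryGroupOfForm (starRingEnd ℂ) J)) : GL (Fin 3) ℂ) : Matrix (Fin 3) (Fin 3) ℂ),
      ((((((η j).1 : ↥K) : ↥(unitaryGroupOfForm (starRingEnd ℂ) J))⁻¹ : ↥(unitaryGroupOfForm (starRingEnd ℂ) J)) : GL (Fin 3) ℂ) :
        Matrix (Fin 3) (Fin 3) ℂ))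
  have hr : Continuous r := by
    refine continuous_pi fun j => ?_
    have hη : Continuous fun η : ({w : {w : InfinitePlace L // IsComplex w} // w ∈ S'} → ↥K × ↥(unipotentU (starRingEnd ℂ) J)) => η j := continuous_apply j
    exact (hcoeJ.comp (continuous_subtype_val.comp (continuous_fst.comp hη))).prodMk
      ((hcoeJ.comp (continuous_subtype_val.comp (continuous_snd.comp hη))).prodMk
        (hcoeJ.comp ((continuous_subtype_val.comp (continuous_fst.comp hη)).inv)))
  obtain ⟨Θ₄, hΘ₄def⟩ : ∃ Θ₄ : ((({w : {w : {w : InfinitePlace L // IsComplex w} // w ∉ S'} // w.1 ∉ E} → Matrix (Fin 3) (Fin 3) ℂ) ×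
        ({w : {w : InfinitePlace L // IsComplex w} // w ∈ S'} → Matrix (Fin 3) (Fin 3) ℂ × Matrix (Fin 3) (Fin 3) ℂ × Matrix (Fin 3) (Fin 3) ℂ)) ×
        (({w : InfinitePlace L // IsComplex w} → Fin 3 → ℝ) × ({w : {w : {w : InfinitePlace L // IsComplex w} // w ∉ S'} // w.1 ∈ E} → Matrix (Fin 3) (Fin 3) ℂ))) → ℂ,
      Θ₄ = fun s => Θa (Λ ((s.1.1, fun j => (s.1.2 j).1 *
          ((((τ ![0, s.2.1 j 1, s.2.1 j 2] : ↥(unitaryGroupOfForm (starRingEnd ℂ) J)) : GL (Fin 3) ℂ) : Matrix (Fin 3) (Fin 3) ℂ) *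
            (((τ ![s.2.1 j 0 / 2, 0, 0] : ↥(unitaryGroupOfForm (starRingEnd ℂ) J)) : GL (Fin 3) ℂ) : Matrix (Fin 3) (Fin 3) ℂ) * (s.1.2 j).2.1 *
            (((τ ![s.2.1 j 0 / 2, 0, 0] : ↥(unitaryGroupOfForm (starRingEnd ℂ) J)) : GL (Fin 3) ℂ) : Matrix (Fin 3) (Fin 3) ℂ)) *
          (s.1.2 j).2.2), s.2.2)) := ⟨_, rfl⟩
  have hgm : ∀ j : {w : {w : InfinitePlace L // IsComplex w} // w ∈ S'},
      ContDiff ℝ ∞ fun c : {w : InfinitePlace L // IsComplex w} → Fin 3 → ℝ => (![0, c j 1, c j 2] : Fin 3 → ℝ) := fun j => by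
    refine contDiff_pi.2 fun i => ?_
    fin_cases i
    · exact contDiff_const
    · exact contDiff_apply_apply ℝ ℝ j.1 1
    · exact contDiff_apply_apply ℝ ℝ j.1 2
  have hgs : ∀ j : {w : {w : InfinitePlace L // IsComplex w} // w ∈ S'},
      ContDiff ℝ ∞ fun c : {w : InfinitePlace L // IsComplex w} → Fin 3 → ℝ => (![c j 0 / 2, 0, 0] : Fin 3 → ℝ) := fun j => by
    refine contDiff_pi.2 fun i => ?_
    fin_cases i
    · exact (contDiff_apply_apply ℝ ℝ j.1 0).div_const 2
    · exact contDiff_const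
    · exact contDiff_const
  have hΘ₄ : ContDiff ℝ ∞ Θ₄ := by
    rw [hΘ₄def]
    refine hΘa.comp (hΛ.comp ((ContDiff.prodMk (contDiff_fst.comp contDiff_fst) (contDiff_pi.2 fun j => ?_)).prodMk (contDiff_snd.comp contDiff_snd)))
    have hD : ContDiff ℝ ∞ fun s : ((({w : {w : {w : InfinitePlace L // IsComplex w} // w ∉ S'} // w.1 ∉ E} → Matrix (Fin 3) (Fin 3) ℂ) ×
        ({w : {w : InfinitePlace L // IsComplex w} // w ∈ S'} → Matrix (Fin 3) (Fin 3) ℂ × Matrix (Fin 3) (Fin 3) ℂ × Matrix (Fin 3) (Fin 3) ℂ)) ×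
        (({w : InfinitePlace L // IsComplex w} → Fin 3 → ℝ) × ({w : {w : {w : InfinitePlace L // IsComplex w} // w ∉ S'} // w.1 ∈ E} → Matrix (Fin 3) (Fin 3) ℂ))) => s.1.2 j :=
      (contDiff_apply ℝ (Matrix (Fin 3) (Fin 3) ℂ × Matrix (Fin 3) (Fin 3) ℂ × Matrix (Fin 3) (Fin 3) ℂ) j).comp (contDiff_snd.comp contDiff_fst)
    have hc : ContDiff ℝ ∞ fun s : ((({w : {w : {w : InfinitePlace L // IsComplex w} // w ∉ S'} // w.1 ∉ E} → Matrix (Fin 3) (Fin 3) ℂ) ×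
        ({w : {w : InfinitePlace L // IsComplex w} // w ∈ S'} → Matrix (Fin 3) (Fin 3) ℂ × Matrix (Fin 3) (Fin 3) ℂ × Matrix (Fin 3) (Fin 3) ℂ)) ×
        (({w : InfinitePlace L // IsComplex w} → Fin 3 → ℝ) × ({w : {w : {w : InfinitePlace L // IsComplex w} // w ∉ S'} // w.1 ∈ E} → Matrix (Fin 3) (Fin 3) ℂ))) => s.2.1 := contDiff_fst.comp contDiff_snd
    have hm := contDiff_coe_torusFamily_comp τ hτcoe ((hgm j).comp hc)
    have hs := contDiff_coe_torusFamily_comp τ hτcoe ((hgs j).comp hc)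
    exact ((contDiff_fst.comp hD).mul (((hm.mul hs).mul (contDiff_fst.comp (contDiff_snd.comp hD))).mul hs)).mul
      (contDiff_snd.comp (contDiff_snd.comp hD))
  have hFΘ : ∀ q g η, F q g η = Θ₄ (((fun w => (((g w : ↥(archLocal L 3 (Matrix.diagonal α) w.1.1)) : GL (Fin 3) ℂ) : Matrix (Fin 3) (Fin 3) ℂ)), r η), q) := by
    intro q g η
    rw [hFdef, hGdef, hΘ₄def]
    simp only [r, Subgroup.coe_mul, Units.val_mul]
  obtain ⟨Ξ, hΞdef⟩ : ∃ Ξ : (({w : InfinitePlace L // IsComplex w} → Fin 3 → ℝ) × ({w : {w : {w : InfinitePlace L // IsComplex w} // w ∉ S'} // w.1 ∈ E} → Matrix (Fin 3) (Fin 3) ℂ)) → ℂ,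
      Ξ = fun q : (({w : InfinitePlace L // IsComplex w} → Fin 3 → ℝ) × ({w : {w : {w : InfinitePlace L // IsComplex w} // w ∉ S'} // w.1 ∈ E} → Matrix (Fin 3) (Fin 3) ℂ)) =>
      ∫ w : ((∀ w : {w : {w : {w : InfinitePlace L // IsComplex w} // w ∉ S'} // w.1 ∉ E}, ↥(archLocal L 3 (Matrix.diagonal α) w.1.1)) ⧸
            Subgroup.pi Set.univ (fun w : {w : {w : {w : InfinitePlace L // IsComplex w} // w ∉ S'} // w.1 ∉ E} => chartTorusGLoc L α w.1.1 S')) ×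
          ({w : {w : InfinitePlace L // IsComplex w} // w ∈ S'} → ↥K × ↥(unipotentU (starRingEnd ℂ) J)),
        descConj (fun w : {w : {w : {w : InfinitePlace L // IsComplex w} // w ∉ S'} // w.1 ∉ E} => gprimeBlock L α w.1.1 S' q.1)
          (Subgroup.pi Set.univ (fun w : {w : {w : {w : InfinitePlace L // IsComplex w} // w ∉ S'} // w.1 ∉ E} => chartTorusGLoc L α w.1.1 S'))
          (forall_mem_pi_chartTorusGLoc_comm L α S' (fun w : {w : {w : {w : InfinitePlace L // IsComplex w} // w ∉ S'} // w.1 ∉ E} => w.1.1) q.1)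
          (fun g => F q g w.2) w.1 ∂(Qrest.prod (Measure.pi fun _ : {w : {w : InfinitePlace L // IsComplex w} // w ∈ S'} => κ.prod μN)) := ⟨_, rfl⟩
  -- ### the compact matrix support of `Θ_{a′}` read block by block
  have h𝒯 : IsCompact (tsupport Θa) := hΘac.isCompact
  have hnz : ∀ mg mu X, Θa (Λ ((mg, mu), X)) ≠ 0 → Λ ((mg, mu), X) ∈ tsupport Θa := fun mg mu X hne => by
    by_contra hout
    exact hne (image_eq_zero_of_notMem_tsupport hout)
  -- rest blocks
  have hArest : ∀ w : {w : {w : {w : InfinitePlace L // IsComplex w} // w ∉ S'} // w.1 ∉ E},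
      IsCompact ((fun g : ↥(archLocal L 3 (Matrix.diagonal α) w.1.1) => ((g : GL (Fin 3) ℂ) : Matrix (Fin 3) (Fin 3) ℂ)) ⁻¹'
        ((fun M : Matrix (Fin 3) (Fin 3) (mixedSpace L) => (Matrix.of fun i j => (M i j).2 w.1.1 : Matrix (Fin 3) (Fin 3) ℂ)) '' tsupport Θa)) := fun w =>
    (hemb w.1.1).isCompact_preimage (h𝒯.image (continuous_blockProj L w.1.1))
  -- ### (a) smoothness through ★ (A4′)
  have hFsupp : ∀ K₁ ⊆ {c : {w : InfinitePlace L // IsComplex w} → Fin 3 → ℝ |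
        ∀ (i : {w : {w : {w : InfinitePlace L // IsComplex w} // w ∉ S'} // w.1 ∉ E}) (a b : Fin 3), a ≠ b →
          slotSign L α ((fun w : {w : {w : {w : InfinitePlace L // IsComplex w} // w ∉ S'} // w.1 ∉ E} => w.1.1) i) a ≠
            slotSign L α ((fun w : {w : {w : {w : InfinitePlace L // IsComplex w} // w ∉ S'} // w.1 ∉ E} => w.1.1) i) b →
          Circle.exp (c ((fun w : {w : {w : {w : InfinitePlace L // IsComplex w} // w ∉ S'} // w.1 ∉ E} => w.1.1) i) a) ≠
            Circle.exp (c ((fun w : {w : {w : {w : InfinitePlace L // IsComplex w} // w ∉ S'} // w.1 ∉ E} => w.1.1) i) b)} ×ˢ (Set.univ : Set ({w : {w : {w : InfinitePlace L // IsComplex w} // w ∉ S'} // w.1 ∈ E} → Matrix (Fin 3) (Fin 3) ℂ)),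
      IsCompact K₁ → ∃ A : Set (∀ w : {w : {w : {w : InfinitePlace L // IsComplex w} // w ∉ S'} // w.1 ∉ E}, ↥(archLocal L 3 (Matrix.diagonal α) w.1.1)),
        ∃ Y₀ : Set ({w : {w : InfinitePlace L // IsComplex w} // w ∈ S'} → ↥K × ↥(unipotentU (starRingEnd ℂ) J)), IsCompact A ∧ IsCompact Y₀ ∧
          ∀ q ∈ K₁, ∀ g η, F q g η ≠ 0 → g ∈ A ∧ η ∈ Y₀ := by
    intro K₁ _ hK₁
    -- coordinates range over a compact set
    have hKV : IsCompact (Prod.fst '' K₁) := hK₁.image continuous_fst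
    -- per split place: the unipotent variables that can contribute lie in ONE compact subset of `N`
    have hΞ : ∀ j : {w : {w : InfinitePlace L // IsComplex w} // w ∈ S'}, ∃ N₀ : Set ↥(unipotentU (starRingEnd ℂ) J), IsCompact N₀ ∧
        ∀ c ∈ Prod.fst '' K₁, ∀ (k : ↥K) (n : ↥(unipotentU (starRingEnd ℂ) J)),
          ((((k : ↥(unitaryGroupOfForm (starRingEnd ℂ) J)) *
              (τ ![0, c j 1, c j 2] * τ ![c j 0 / 2, 0, 0] * (n : ↥(unitaryGroupOfForm (starRingEnd ℂ) J)) * τ ![c j 0 / 2, 0, 0]) *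
              (k : ↥(unitaryGroupOfForm (starRingEnd ℂ) J))⁻¹ : ↥(unitaryGroupOfForm (starRingEnd ℂ) J)) : GL (Fin 3) ℂ) : Matrix (Fin 3) (Fin 3) ℂ) ∈
            (fun M : Matrix (Fin 3) (Fin 3) ℂ => ((T j : GL (Fin 3) ℂ) : Matrix (Fin 3) (Fin 3) ℂ) * M * (((T j)⁻¹ : GL (Fin 3) ℂ) : Matrix (Fin 3) (Fin 3) ℂ)) ''
              ((fun M : Matrix (Fin 3) (Fin 3) (mixedSpace L) => (Matrix.of fun i j' => (M i j').2 j.1 : Matrix (Fin 3) (Fin 3) ℂ)) '' tsupport Θa) → n ∈ N₀ := by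
      intro j
      have hct : ∀ g : ({w : InfinitePlace L // IsComplex w} → Fin 3 → ℝ) → (Fin 3 → ℝ), ContDiff ℝ ∞ g →
          Continuous fun c => τ (g c) := fun g hg =>
        continuous_of_coe Complex.continuous_conj hJJ (contDiff_coe_torusFamily_comp τ hτcoe hg).continuous
      -- the compact set of group elements with matrix in the transported block support
      have hB : IsCompact ((fun g : ↥(unitaryGroupOfForm (starRingEnd ℂ) J) => ((g : GL (Fin 3) ℂ) : Matrix (Fin 3) (Fin 3) ℂ)) ⁻¹'
          ((fun M : Matrix (Fin 3) (Fin 3) ℂ => ((T j : GL (Fin 3) ℂ) : Matrix (Fin 3) (Fin 3) ℂ) * M * (((T j)⁻¹ : GL (Fin 3) ℂ) : Matrix (Fin 3) (Fin 3) ℂ)) ''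
            ((fun M : Matrix (Fin 3) (Fin 3) (mixedSpace L) => (Matrix.of fun i j' => (M i j').2 j.1 : Matrix (Fin 3) (Fin 3) ℂ)) '' tsupport Θa))) :=
        hembJ.isCompact_preimage (((h𝒯.image (continuous_blockProj L j.1)).image ((continuous_const.mul continuous_id).mul continuous_const)))
      obtain ⟨Ξj, hΞjdef⟩ : ∃ Ξj : (({w : InfinitePlace L // IsComplex w} → Fin 3 → ℝ) × ↥(unitaryGroupOfForm (starRingEnd ℂ) J)) ×
          ↥(unitaryGroupOfForm (starRingEnd ℂ) J) → ↥(unitaryGroupOfForm (starRingEnd ℂ) J),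
          Ξj = fun q => (τ ![0, q.1.1 j 1, q.1.1 j 2] * τ ![q.1.1 j 0 / 2, 0, 0])⁻¹ * ((q.1.2)⁻¹ * q.2 * q.1.2) *
            (τ ![q.1.1 j 0 / 2, 0, 0])⁻¹ := ⟨_, rfl⟩
      have hΞjc : Continuous Ξj := by
        rw [hΞjdef]
        have h1 : Continuous fun q : (({w : InfinitePlace L // IsComplex w} → Fin 3 → ℝ) × ↥(unitaryGroupOfForm (starRingEnd ℂ) J)) ×
            ↥(unitaryGroupOfForm (starRingEnd ℂ) J) => τ ![0, q.1.1 j 1, q.1.1 j 2] :=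
          (hct _ (hgm j)).comp (continuous_fst.comp continuous_fst)
        have h2 : Continuous fun q : (({w : InfinitePlace L // IsComplex w} → Fin 3 → ℝ) × ↥(unitaryGroupOfForm (starRingEnd ℂ) J)) ×
            ↥(unitaryGroupOfForm (starRingEnd ℂ) J) => τ ![q.1.1 j 0 / 2, 0, 0] :=
          (hct _ (hgs j)).comp (continuous_fst.comp continuous_fst)
        have hk : Continuous fun q : (({w : InfinitePlace L // IsComplex w} → Fin 3 → ℝ) × ↥(unitaryGroupOfForm (starRingEnd ℂ) J)) ×
            ↥(unitaryGroupOfForm (starRingEnd ℂ) J) => q.1.2 := continuous_snd.comp continuous_fst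
        exact ((h1.mul h2).inv.mul ((hk.inv.mul continuous_snd).mul hk)).mul h2.inv
      refine ⟨Subtype.val ⁻¹' (Ξj '' (((Prod.fst '' K₁) ×ˢ (K : Set ↥(unitaryGroupOfForm (starRingEnd ℂ) J))) ×ˢ _)),
        hN.isClosedEmbedding_subtypeVal.isCompact_preimage (((hKV.prod hK).prod hB).image hΞjc), ?_⟩
      intro c hc k n hv
      refine ⟨((c, (k : ↥(unitaryGroupOfForm (starRingEnd ℂ) J))), _), Set.mk_mem_prod (Set.mk_mem_prod hc k.2) hv, ?_⟩
      rw [hΞjdef]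
      simp only
      group
    choose N₀ hN₀c hN₀ using hΞ
    refine ⟨Set.pi Set.univ fun w => (fun g : ↥(archLocal L 3 (Matrix.diagonal α) w.1.1) => ((g : GL (Fin 3) ℂ) : Matrix (Fin 3) (Fin 3) ℂ)) ⁻¹'
        ((fun M : Matrix (Fin 3) (Fin 3) (mixedSpace L) => (Matrix.of fun i j => (M i j).2 w.1.1 : Matrix (Fin 3) (Fin 3) ℂ)) '' tsupport Θa),
      Set.pi Set.univ fun j => (Set.univ : Set ↥K) ×ˢ N₀ j, isCompact_univ_pi hArest, isCompact_univ_pi fun j => isCompact_univ.prod (hN₀c j), ?_⟩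
    intro q hq g η hne
    rw [hFdef, hGdef] at hne
    dsimp only at hne
    have hmem := hnz _ _ _ hne
    refine ⟨Set.mem_univ_pi.2 fun w => ?_, Set.mem_univ_pi.2 fun j => Set.mk_mem_prod (Set.mem_univ _) (hN₀ j q.1 ⟨q, hq, rfl⟩ (η j).1 (η j).2 ?_)⟩
    · refine ⟨_, hmem, ?_⟩
      exact hproj_rest w _ _ _
    · refine ⟨_, ⟨_, hmem, rfl⟩, ?_⟩
      dsimp only
      rw [hproj_split, ← Matrix.mul_assoc, ← Matrix.mul_assoc, ← Units.val_mul, mul_inv_cancel, Units.val_one, Matrix.one_mul, Matrix.mul_assoc,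
        ← Units.val_mul, mul_inv_cancel, Units.val_one, Matrix.mul_one]
  have hA4 := contDiffOn_smoothModel_prod_param L α S' hα hreal hS' (fun w : {w : {w : {w : InfinitePlace L // IsComplex w} // w ∉ S'} // w.1 ∉ E} => w.1.1)
    (fun w => w.1.2) Qrest (Measure.pi fun _ : {w : {w : InfinitePlace L // IsComplex w} // w ∈ S'} => κ.prod μN) isOpen_univ r hr F Θ₄ hΘ₄ hFΘ hFsupp
    (fun _ => (1 : ℂ)) contDiffOn_const
  refine ⟨Ξ, ?_, ?_, ?_, ?_⟩
  · -- (a)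
    rw [hΞdef]
    exact hA4.congr fun q _ => (one_mul _).symm
  · -- (b) the `u`-support: the `E`-blocks of the point are the `↑↑u_w`
    refine ⟨Set.univ.pi fun w : {w : {w : {w : InfinitePlace L // IsComplex w} // w ∉ S'} // w.1 ∈ E} => (fun g : ↥(archLocal L 3 (Matrix.diagonal α) w.1.1) => ((g : GL (Fin 3) ℂ) : Matrix (Fin 3) (Fin 3) ℂ)) ⁻¹'
        ((fun M : Matrix (Fin 3) (Fin 3) (mixedSpace L) => (Matrix.of fun i j => (M i j).2 w.1.1 : Matrix (Fin 3) (Fin 3) ℂ)) '' tsupport Θa),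
      isCompact_univ_pi fun w => (hemb w.1.1).isCompact_preimage (h𝒯.image (continuous_blockProj L w.1.1)), fun c u hu => ?_⟩
    obtain ⟨w, hw⟩ : ∃ w : {w : {w : {w : InfinitePlace L // IsComplex w} // w ∉ S'} // w.1 ∈ E}, u w ∉ (fun g : ↥(archLocal L 3 (Matrix.diagonal α) w.1.1) => ((g : GL (Fin 3) ℂ) : Matrix (Fin 3) (Fin 3) ℂ)) ⁻¹'
        ((fun M : Matrix (Fin 3) (Fin 3) (mixedSpace L) => (Matrix.of fun i j => (M i j).2 w.1.1 : Matrix (Fin 3) (Fin 3) ℂ)) '' tsupport Θa) := by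
      simpa only [Set.mem_univ_pi, not_forall] using hu
    refine integral_eq_zero_of_ae (Filter.Eventually.of_forall fun q => ?_)
    dsimp only [Pi.zero_apply]
    rw [hΘf]
    by_contra hne
    apply hw
    refine ⟨_, not_not.1 fun hout => hne (image_eq_zero_of_notMem_tsupport hout), ?_⟩
    rw [coe_archPiEquivCM_symm_apply]
    ext i j
    simp only [Matrix.of_apply]
    rw [dif_neg w.1.2, dif_pos w.2]
  · -- (c) `B(c, u) = Ξ(c, ↑↑u)`: the swap, then the matrix reading of the recombined element
    intro c u
    rw [hΞdef]
    dsimp only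
    rw [integral_prod_eq_integral_swap_descConj
      (fun w : {w : {w : {w : InfinitePlace L // IsComplex w} // w ∉ S'} // w.1 ∉ E} => gprimeBlock L α w.1.1 S' c)
      (Subgroup.pi Set.univ (fun w : {w : {w : {w : InfinitePlace L // IsComplex w} // w ∉ S'} // w.1 ∉ E} => chartTorusGLoc L α w.1.1 S'))
      (forall_mem_pi_chartTorusGLoc_comm L α S' (fun w : {w : {w : {w : InfinitePlace L // IsComplex w} // w ∉ S'} // w.1 ∉ E} => w.1.1) c)
      (Measure.pi fun _ : {w : {w : InfinitePlace L // IsComplex w} // w ∈ S'} => κ.prod μN) Qrest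
      (fun z : (∀ w : {w : InfinitePlace L // IsComplex w}, ↥(archLocal L 3 (Matrix.diagonal α) w)) => a' ((archPiEquivCM 3 L (Matrix.diagonal α)).symm z))
      (fun p : (∀ w : {w : {w : {w : InfinitePlace L // IsComplex w} // w ∉ S'} // w.1 ∉ E}, ↥(archLocal L 3 (Matrix.diagonal α) w.1.1)) ×
          ({w : {w : InfinitePlace L // IsComplex w} // w ∈ S'} → ↥K × ↥(unipotentU (starRingEnd ℂ) J)) =>
        fun w =>
          if h : w ∈ S' then
            (φ ⟨w, h⟩).symm (((p.2 ⟨w, h⟩).1 : ↥(unitaryGroupOfForm (starRingEnd ℂ) J)) *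
              (τ ![0, c w 1, c w 2] * τ ![c w 0 / 2, 0, 0] * ((p.2 ⟨w, h⟩).2 : ↥(unitaryGroupOfForm (starRingEnd ℂ) J)) * τ ![c w 0 / 2, 0, 0]) *
              ((p.2 ⟨w, h⟩).1 : ↥(unitaryGroupOfForm (starRingEnd ℂ) J))⁻¹)
          else if hE : w ∈ E then (u ⟨⟨w, h⟩, hE⟩ : ↥(archLocal L 3 (Matrix.diagonal α) w))
          else (p.1 ⟨⟨w, h⟩, hE⟩ : ↥(archLocal L 3 (Matrix.diagonal α) w)))
      (fun q : ({w : {w : InfinitePlace L // IsComplex w} // w ∈ S'} → ↥K × ↥(unipotentU (starRingEnd ℂ) J)) ×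
          ((∀ w : {w : {w : {w : InfinitePlace L // IsComplex w} // w ∉ S'} // w.1 ∉ E}, ↥(archLocal L 3 (Matrix.diagonal α) w.1.1)) ⧸
            Subgroup.pi Set.univ (fun w : {w : {w : {w : InfinitePlace L // IsComplex w} // w ∉ S'} // w.1 ∉ E} => chartTorusGLoc L α w.1.1 S')) =>
        a' ((archPiEquivCM 3 L (Matrix.diagonal α)).symm (fun w =>
          if h : w ∈ S' then
            (φ ⟨w, h⟩).symm (((q.1 ⟨w, h⟩).1 : ↥(unitaryGroupOfForm (starRingEnd ℂ) J)) *
              (τ ![0, c w 1, c w 2] * τ ![c w 0 / 2, 0, 0] * ((q.1 ⟨w, h⟩).2 : ↥(unitaryGroupOfForm (starRingEnd ℂ) J)) * τ ![c w 0 / 2, 0, 0]) *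
              ((q.1 ⟨w, h⟩).1 : ↥(unitaryGroupOfForm (starRingEnd ℂ) J))⁻¹)
          else if hE : w ∈ E then (u ⟨⟨w, h⟩, hE⟩ : ↥(archLocal L 3 (Matrix.diagonal α) w))
          else
            descConj (fun w : {w : {w : {w : InfinitePlace L // IsComplex w} // w ∉ S'} // w.1 ∉ E} => gprimeBlock L α w.1.1 S' c)
              (Subgroup.pi Set.univ (fun w : {w : {w : {w : InfinitePlace L // IsComplex w} // w ∉ S'} // w.1 ∉ E} => chartTorusGLoc L α w.1.1 S'))
              (forall_mem_pi_chartTorusGLoc_comm L α S' (fun w : {w : {w : {w : InfinitePlace L // IsComplex w} // w ∉ S'} // w.1 ∉ E} => w.1.1) c)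
              (fun g => (g ⟨⟨w, h⟩, hE⟩ : ↥(archLocal L 3 (Matrix.diagonal α) w))) q.2)))
      (fun η g => rfl)]
    refine integral_congr_ae (Filter.Eventually.of_forall fun w => ?_)
    dsimp only
    congr 1
    funext g
    -- `a′ (e⁻¹ (…, [w ∈ E] u_w, …)) = Θ_{a′} (Λ ((↑↑g, movers), ↑↑u))`
    rw [hFdef, hGdef, hΘf]
    dsimp only
    congr 1
    rw [coe_archPiEquivCM_symm_apply, hΛapply]
    refine Matrix.ext fun i j => Prod.ext rfl (funext fun w => ?_)
    simp only [Matrix.of_apply]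
    by_cases h : w ∈ S'
    · rw [dif_pos h, dif_pos h, hsymm, Units.val_mul, Units.val_mul]
    · by_cases hE : w ∈ E
      · rw [dif_neg h, dif_pos hE, dif_neg h, dif_pos hE]
      · rw [dif_neg h, dif_neg hE, dif_neg h, dif_neg hE]
  · -- (d) `Ξ` does not see the `E`-coordinates
    intro c c' X hcc'
    have hupd : ∀ j : {w : {w : InfinitePlace L // IsComplex w} // w ∈ S'}, c j.1 = c' j.1 := fun j =>
      hcc' j.1 fun hjE => hES j.1 hjE j.2
    have hF : F (c, X) = F (c', X) := by
      rw [hFdef]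
      exact congrArg (fun cs : {w : {w : InfinitePlace L // IsComplex w} // w ∈ S'} → Fin 3 → ℝ => G (cs, X)) (funext hupd)
    have hγ : (fun w : {w : {w : {w : InfinitePlace L // IsComplex w} // w ∉ S'} // w.1 ∉ E} => gprimeBlock L α w.1.1 S' c) =
        fun w : {w : {w : {w : InfinitePlace L // IsComplex w} // w ∉ S'} // w.1 ∉ E} => gprimeBlock L α w.1.1 S' c' := by
      funext w
      rw [gprimeBlock_eq_gprimeBlockAt, gprimeBlock_eq_gprimeBlockAt, hcc' w.1.1 w.2]
    have key : ∀ (γ₁ γ₂ : ∀ w : {w : {w : {w : InfinitePlace L // IsComplex w} // w ∉ S'} // w.1 ∉ E}, ↥(archLocal L 3 (Matrix.diagonal α) w.1.1))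
        (h₁ : ∀ m ∈ Subgroup.pi Set.univ (fun w : {w : {w : {w : InfinitePlace L // IsComplex w} // w ∉ S'} // w.1 ∉ E} => chartTorusGLoc L α w.1.1 S'), m * γ₁ = γ₁ * m)
        (h₂ : ∀ m ∈ Subgroup.pi Set.univ (fun w : {w : {w : {w : InfinitePlace L // IsComplex w} // w ∉ S'} // w.1 ∉ E} => chartTorusGLoc L α w.1.1 S'), m * γ₂ = γ₂ * m)
        (f : (∀ w : {w : {w : {w : InfinitePlace L // IsComplex w} // w ∉ S'} // w.1 ∉ E}, ↥(archLocal L 3 (Matrix.diagonal α) w.1.1)) → ℂ),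
        γ₁ = γ₂ → descConj γ₁ _ h₁ f = descConj γ₂ _ h₂ f := by
      intro γ₁ γ₂ h₁ h₂ f hγ
      subst hγ
      rfl
    rw [hΞdef]
    dsimp only
    rw [hF]
    refine integral_congr_ae (Filter.Eventually.of_forall fun w => ?_)
    exact congrFun (key _ _ (forall_mem_pi_chartTorusGLoc_comm L α S' (fun w : {w : {w : {w : InfinitePlace L // IsComplex w} // w ∉ S'} // w.1 ∉ E} => w.1.1) c)
      (forall_mem_pi_chartTorusGLoc_comm L α S' (fun w : {w : {w : {w : InfinitePlace L // IsComplex w} // w ∉ S'} // w.1 ∉ E} => w.1.1) c')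
      (fun g => F (c', X) g w.2) hγ) w.1

end HeldOut

end Literature.NumberTheory.Rogawski1990

end
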